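import Summits.AnomalousDissipation.AnomalousDissipation.Theorems.TwodBoundedEnergyZeroMomentum.Negative.FirstShellGalerkin
import Literature.Barriers.AnomalousDissipation.GravestModeLaminarAttractorShellPincer
import Literature.Analysis.FluidPDE.NSHopfLimit

/-!
# The single-shell pincer for every Leray–Hopf solution, I: spectral bookkeeping
(negative-side support for the crux `TwoAndHalfD.TwodBoundedEnergyZeroMomentum`, cdisprove seat
`refuter-cdisprove-stmt-AnomalousDissipation-10786-g2-0`, gen 2, cycle 2)

Toward the theorem (sibling `ShellPincer`): under a steady force supported on ONE Fourier shell
`|k|² = m` (Kolmogorov forcing at any Stokes eigenvalue `Λ = 4π²m`), EVERY global Leray–Hopf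
solution on `𝕋²` from `L²` data obeys `‖∇u(t)‖₂² ≤ Λ‖u(t)‖₂² + K e^{-8π²mν(t-1)}` for `t ≥ 1`
(Tran–Shepherd 2002 §4; Constantin–Tarfulea–Vicol 2013 §2 (diffeq)–(enst), there for smooth data
with `δ₊(0)` in place of the transient), hence limsup-mean enstrophy `≤ Λ ×` mean energy and
`meanDissipation ≤ νΛ × meanEnergy`.  The tree proves the decay of the signed shell excess
`ξ = ‖∇u‖² - Λ|u|²` at the GALERKIN level (`galerkin_shellExcess_le_mul_exp`); the passage to the
Leray–Hopf limit at a FIXED time uses that `ξ = Φ⁺ - Φ⁻` with `Φ⁺ = ∑ (4π²(|k|²-m))⁺‖v̂(k)‖²`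
lower semicontinuous under coefficientwise convergence (Fatou) and `Φ⁻ = ∑_{|k|²<m} 4π²(m-|k|²)‖v̂(k)‖²`
a FINITE sum, hence continuous.  This file: the spectral functionals and their identities.

* `shellPlus m v`, `shellMinus m v` (the two `ℝ≥0∞` series; `ofReal` clips the wrong-signed
  weights) — local abbreviations via `def`-free `notation`? No: stated inline as `∑'` terms.
* `eGradNormSq_add_shellMinus_eq` — `‖∇v‖² + Φ⁻(v) = Φ⁺(v) + Λ ∑‖v̂‖²` (termwise).
* `galerkin_shellExcess_eq_toReal_sub_toReal` — for a Galerkin state the tree's signed excess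
  `∑_{k∈S} 4π²(|k|²-m)‖c k‖²` equals `Φ⁺.toReal - Φ⁻.toReal`.
* `shellPlus_le_liminf`, `tendsto_shellMinus` — Fatou for `Φ⁺`, continuity of `Φ⁻` under
  coefficientwise convergence.
-/

noncomputable section

open MeasureTheory Set Filter Topology UnitAddTorus
open scoped ENNReal NNReal InnerProductSpace

namespace Summit.AnomalousDissipation.AnomalousDissipation.Theorems.TwodBoundedEnergyZeroMomentum.Negative

open Literature.Analysis.FunctionSpaces Literature.Analysis.FunctionSpaces.Torus
open Literature.Analysis.FluidPDE Literature.Analysis.FluidPDE.Torus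
open Literature.Barriers.AnomalousDissipation

section Spectral

variable (m : ℝ)

/-- Termwise: `4π²|k|² a + (4π²(m-|k|²))⁺ a = (4π²(|k|²-m))⁺ a + 4π²m a` in `ℝ≥0∞` (`ofReal` clips). [folklore] -/
theorem shell_weights_termwise (hm : 0 ≤ m) (k : Fin 2 → ℤ) (a : ℝ≥0∞) :
    ENNReal.ofReal (4 * Real.pi ^ 2) * (ENNReal.ofReal (freqNormSq k) * a) +
        ENNReal.ofReal (4 * Real.pi ^ 2 * (m - freqNormSq k)) * a =
      ENNReal.ofReal (4 * Real.pi ^ 2 * (freqNormSq k - m)) * a + ENNReal.ofReal (4 * Real.pi ^ 2 * m) * a := by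
  have hπ : 0 ≤ 4 * Real.pi ^ 2 := by positivity
  have hk := freqNormSq_nonneg k
  rw [← mul_assoc, ← ENNReal.ofReal_mul hπ, ← add_mul, ← add_mul]
  congr 1
  rcases le_total m (freqNormSq k) with h | h
  · rw [ENNReal.ofReal_of_nonpos (by nlinarith : 4 * Real.pi ^ 2 * (m - freqNormSq k) ≤ 0), add_zero,
      ← ENNReal.ofReal_add (by nlinarith) (by nlinarith)]
    congr 1
    ring
  · rw [ENNReal.ofReal_of_nonpos (by nlinarith : 4 * Real.pi ^ 2 * (freqNormSq k - m) ≤ 0), zero_add,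
      ← ENNReal.ofReal_add (by nlinarith) (by nlinarith)]
    congr 1
    ring

/-- **`‖∇v‖₂² + Φ⁻(v) = Φ⁺(v) + 4π²m ∑‖v̂(k)‖²`** for every field (spectral identity in `ℝ≥0∞`;
`Φ⁺ = ∑ (4π²(|k|²-m))⁺‖v̂‖²`, `Φ⁻ = ∑ (4π²(m-|k|²))⁺‖v̂‖²`). [folklore] -/
theorem eGradNormSq_add_shellMinus_eq (hm : 0 ≤ m) (v : UnitAddTorus (Fin 2) → EuclideanSpace ℝ (Fin 2)) :
    eGradNormSq v + ∑' k : Fin 2 → ℤ, ENNReal.ofReal (4 * Real.pi ^ 2 * (m - freqNormSq k)) *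
        ‖mFourierCoeff (EuclideanSpace.complexify ∘ v) k‖ₑ ^ 2 =
      (∑' k : Fin 2 → ℤ, ENNReal.ofReal (4 * Real.pi ^ 2 * (freqNormSq k - m)) *
        ‖mFourierCoeff (EuclideanSpace.complexify ∘ v) k‖ₑ ^ 2) +
      ENNReal.ofReal (4 * Real.pi ^ 2 * m) *
        ∑' k : Fin 2 → ℤ, ‖mFourierCoeff (EuclideanSpace.complexify ∘ v) k‖ₑ ^ 2 := by
  rw [eGradNormSq_eq_tsum, ← ENNReal.tsum_mul_left, ← ENNReal.tsum_mul_left, ← ENNReal.tsum_add,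
    ← ENNReal.tsum_add]
  exact tsum_congr fun k => shell_weights_termwise m hm k _

/-- For a finitely supported coefficient family the clipped series are finite sums:
`∑' ofReal(w k) ‖coeffExt S c k‖ₑ² = ∑_{k ∈ S} ofReal(w k) ‖c k‖ₑ²`. [folklore] -/
theorem tsum_ofReal_mul_enorm_sq_coeffExt {S : Finset (Fin 2 → ℤ)} (w : (Fin 2 → ℤ) → ℝ)
    (c : ↥S → EuclideanSpace ℂ (Fin 2)) :
    ∑' k : Fin 2 → ℤ, ENNReal.ofReal (w k) * ‖coeffExt S c k‖ₑ ^ 2 =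
      ∑ k : ↥S, ENNReal.ofReal (w k) * ‖c k‖ₑ ^ 2 := by
  classical
  rw [tsum_eq_sum (s := S) fun k hk => by rw [coeffExt_of_not_mem _ hk, enorm_zero, zero_pow two_ne_zero, mul_zero],
    ← sum_coeffExt (fun k v => ENNReal.ofReal (w k) * ‖v‖ₑ ^ 2)]

/-- **The signed Galerkin shell excess is `Φ⁺ - Φ⁻`**: for a finitely supported coefficient family
`c` on `S`, `∑_{k∈S} 4π²(|k|²-m)‖c k‖² = (∑_{k∈S} (4π²(|k|²-m))⁺‖c k‖²) - ∑_{k∈S}(4π²(m-|k|²))⁺‖c k‖²`,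
with the two clipped sums written as `toReal` of the `ℝ≥0∞` series of `coeffExt S c`. [folklore] -/
theorem galerkin_shellExcess_eq_toReal_sub_toReal {S : Finset (Fin 2 → ℤ)}
    (c : ↥S → EuclideanSpace ℂ (Fin 2)) :
    ∑ k : ↥S, (4 * Real.pi ^ 2 * (freqNormSq (k : Fin 2 → ℤ) - m)) * ‖c k‖ ^ 2 =
      (∑' k : Fin 2 → ℤ, ENNReal.ofReal (4 * Real.pi ^ 2 * (freqNormSq k - m)) *
          ‖coeffExt S c k‖ₑ ^ 2).toReal -
        (∑' k : Fin 2 → ℤ, ENNReal.ofReal (4 * Real.pi ^ 2 * (m - freqNormSq k)) *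
          ‖coeffExt S c k‖ₑ ^ 2).toReal := by
  rw [tsum_ofReal_mul_enorm_sq_coeffExt, tsum_ofReal_mul_enorm_sq_coeffExt,
    ENNReal.toReal_sum (fun k _ => ENNReal.mul_ne_top ENNReal.ofReal_ne_top (ENNReal.pow_ne_top enorm_ne_top)),
    ENNReal.toReal_sum (fun k _ => ENNReal.mul_ne_top ENNReal.ofReal_ne_top (ENNReal.pow_ne_top enorm_ne_top)),
    ← Finset.sum_sub_distrib]
  refine Finset.sum_congr rfl fun k _ => ?_
  have hsq : (‖c k‖ₑ ^ 2).toReal = ‖c k‖ ^ 2 := by rw [ENNReal.toReal_pow, toReal_enorm]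
  rw [ENNReal.toReal_mul, ENNReal.toReal_mul, hsq]
  have hπ : (0 : ℝ) ≤ 4 * Real.pi ^ 2 := by positivity
  rcases le_total m (freqNormSq (k : Fin 2 → ℤ)) with h | h
  · have h1 : 0 ≤ 4 * Real.pi ^ 2 * (freqNormSq (k : Fin 2 → ℤ) - m) := mul_nonneg hπ (sub_nonneg.2 h)
    have h2 : 4 * Real.pi ^ 2 * (m - freqNormSq (k : Fin 2 → ℤ)) ≤ 0 :=
      mul_nonpos_of_nonneg_of_nonpos hπ (sub_nonpos.2 h)
    rw [ENNReal.toReal_ofReal h1, ENNReal.ofReal_of_nonpos h2, ENNReal.toReal_zero]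
    ring
  · have h1 : 4 * Real.pi ^ 2 * (freqNormSq (k : Fin 2 → ℤ) - m) ≤ 0 :=
      mul_nonpos_of_nonneg_of_nonpos hπ (sub_nonpos.2 h)
    have h2 : 0 ≤ 4 * Real.pi ^ 2 * (m - freqNormSq (k : Fin 2 → ℤ)) := mul_nonneg hπ (sub_nonneg.2 h)
    rw [ENNReal.ofReal_of_nonpos h1, ENNReal.toReal_zero, ENNReal.toReal_ofReal h2]
    ring

variable {U : ℕ → ℝ → UnitAddTorus (Fin 2) → EuclideanSpace ℝ (Fin 2)}
  {u : ℝ → UnitAddTorus (Fin 2) → EuclideanSpace ℝ (Fin 2)}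

/-- **Fatou for `Φ⁺` at a fixed time**: coefficientwise convergence gives
`Φ⁺(u(t)) ≤ liminf_n Φ⁺(U n(t))`. [folklore] -/
theorem shellPlus_le_liminf
    (hc : ∀ t, 0 ≤ t → ∀ k, Tendsto (fun n => mFourierCoeff (EuclideanSpace.complexify ∘ U n t) k)
      atTop (𝓝 (mFourierCoeff (EuclideanSpace.complexify ∘ u t) k))) {t : ℝ} (ht : 0 ≤ t) :
    (∑' k : Fin 2 → ℤ, ENNReal.ofReal (4 * Real.pi ^ 2 * (freqNormSq k - m)) *
        ‖mFourierCoeff (EuclideanSpace.complexify ∘ u t) k‖ₑ ^ 2) ≤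
      liminf (fun n => ∑' k : Fin 2 → ℤ, ENNReal.ofReal (4 * Real.pi ^ 2 * (freqNormSq k - m)) *
        ‖mFourierCoeff (EuclideanSpace.complexify ∘ U n t) k‖ₑ ^ 2) atTop := by
  refine ENNReal.tsum_le_liminf_tsum fun k => ?_
  refine ENNReal.Tendsto.const_mul ?_ (Or.inr ENNReal.ofReal_ne_top)
  exact ((ENNReal.continuous_pow 2).tendsto _).comp (hc t ht k).enorm

/-- **`Φ⁻` is continuous at a fixed time**: it is a FINITE sum (frequencies `|k|² < m` only),
each term of which converges. [folklore] -/
theorem tendsto_shellMinus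
    (hc : ∀ t, 0 ≤ t → ∀ k, Tendsto (fun n => mFourierCoeff (EuclideanSpace.complexify ∘ U n t) k)
      atTop (𝓝 (mFourierCoeff (EuclideanSpace.complexify ∘ u t) k))) {t : ℝ} (ht : 0 ≤ t) :
    Tendsto (fun n => ∑' k : Fin 2 → ℤ, ENNReal.ofReal (4 * Real.pi ^ 2 * (m - freqNormSq k)) *
        ‖mFourierCoeff (EuclideanSpace.complexify ∘ U n t) k‖ₑ ^ 2) atTop
      (𝓝 (∑' k : Fin 2 → ℤ, ENNReal.ofReal (4 * Real.pi ^ 2 * (m - freqNormSq k)) *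
        ‖mFourierCoeff (EuclideanSpace.complexify ∘ u t) k‖ₑ ^ 2)) := by
  classical
  -- the finite set of sub-shell frequencies
  set N : ℕ := ⌈m⌉₊ with hN
  set B : Finset (Fin 2 → ℤ) := freqBall N with hB
  have hzero : ∀ (v : UnitAddTorus (Fin 2) → EuclideanSpace ℝ (Fin 2)) (k : Fin 2 → ℤ), k ∉ B →
      ENNReal.ofReal (4 * Real.pi ^ 2 * (m - freqNormSq k)) *
        ‖mFourierCoeff (EuclideanSpace.complexify ∘ v) k‖ₑ ^ 2 = 0 := by
    intro v k hk
    rw [hB, not_mem_freqBall] at hk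
    have hmN : m ≤ (N : ℝ) ^ 2 := by
      have h1 : m ≤ (N : ℝ) := Nat.le_ceil m
      rcases le_or_gt m 0 with h0 | h0
      · exact h0.trans (by positivity)
      · have h2 : (1 : ℝ) ≤ N := by
          have : (0 : ℝ) < N := h0.trans_le h1
          have h3 : 1 ≤ N := Nat.one_le_iff_ne_zero.2 (by
            intro hz
            rw [hz, Nat.cast_zero] at this
            exact lt_irrefl _ this)
          exact_mod_cast h3
        nlinarith
    have hle : 4 * Real.pi ^ 2 * (m - freqNormSq k) ≤ 0 := by
      have : m - freqNormSq k ≤ 0 := by linarith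
      exact mul_nonpos_of_nonneg_of_nonpos (by positivity) this |> fun h => by nlinarith [Real.pi_pos]
    rw [ENNReal.ofReal_of_nonpos hle, zero_mul]
  have hsum : ∀ v : UnitAddTorus (Fin 2) → EuclideanSpace ℝ (Fin 2),
      (∑' k : Fin 2 → ℤ, ENNReal.ofReal (4 * Real.pi ^ 2 * (m - freqNormSq k)) *
        ‖mFourierCoeff (EuclideanSpace.complexify ∘ v) k‖ₑ ^ 2) =
      ∑ k ∈ B, ENNReal.ofReal (4 * Real.pi ^ 2 * (m - freqNormSq k)) *
        ‖mFourierCoeff (EuclideanSpace.complexify ∘ v) k‖ₑ ^ 2 := fun v =>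
    tsum_eq_sum fun k hk => hzero v k hk
  simp_rw [hsum]
  refine tendsto_finsetSum _ fun k _ => ?_
  refine ENNReal.Tendsto.const_mul ?_ (Or.inr ENNReal.ofReal_ne_top)
  exact ((ENNReal.continuous_pow 2).tendsto _).comp (hc t ht k).enorm

/-- `Φ⁻(v) ≤ 4π²m ∑‖v̂‖² = 4π²m ∫‖v‖²` is finite for `v ∈ L²`. [folklore] -/
theorem shellMinus_le (hm : 0 ≤ m) {v : UnitAddTorus (Fin 2) → EuclideanSpace ℝ (Fin 2)} (hv : MemLp v 2 volume) :
    (∑' k : Fin 2 → ℤ, ENNReal.ofReal (4 * Real.pi ^ 2 * (m - freqNormSq k)) *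
        ‖mFourierCoeff (EuclideanSpace.complexify ∘ v) k‖ₑ ^ 2) ≤
      ENNReal.ofReal (4 * Real.pi ^ 2 * m * ∫ x, ‖v x‖ ^ 2) := by
  have h1 : (∑' k : Fin 2 → ℤ, ENNReal.ofReal (4 * Real.pi ^ 2 * (m - freqNormSq k)) *
      ‖mFourierCoeff (EuclideanSpace.complexify ∘ v) k‖ₑ ^ 2) ≤
      ∑' k : Fin 2 → ℤ, ENNReal.ofReal (4 * Real.pi ^ 2 * m) *
        ‖mFourierCoeff (EuclideanSpace.complexify ∘ v) k‖ₑ ^ 2 := by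
    refine ENNReal.tsum_le_tsum fun k => mul_le_mul_left (ENNReal.ofReal_le_ofReal ?_) _
    have := freqNormSq_nonneg k
    nlinarith [Real.pi_pos, sq_nonneg Real.pi, mul_nonneg (by positivity : (0:ℝ) ≤ 4 * Real.pi ^ 2) this]
  refine h1.trans ?_
  rw [ENNReal.tsum_mul_left, Torus.tsum_enorm_sq_mFourierCoeff_complexify hv, Torus.lintegral_enorm_sq_eq_ofReal hv,
    ← ENNReal.ofReal_mul (by positivity)]

/-- **From the signed excess to the clipped series** (Galerkin states): if
`∑_{k∈S} 4π²(|k|²-m)‖c k‖² ≤ r` then `Φ⁺ ≤ Φ⁻ + ofReal r` for the family `coeffExt S c`. [folklore] -/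
theorem shellPlus_le_of_excess_le {S : Finset (Fin 2 → ℤ)} (c : ↥S → EuclideanSpace ℂ (Fin 2)) {r : ℝ}
    (hr : 0 ≤ r) (h : ∑ k : ↥S, (4 * Real.pi ^ 2 * (freqNormSq (k : Fin 2 → ℤ) - m)) * ‖c k‖ ^ 2 ≤ r) :
    (∑' k : Fin 2 → ℤ, ENNReal.ofReal (4 * Real.pi ^ 2 * (freqNormSq k - m)) * ‖coeffExt S c k‖ₑ ^ 2) ≤
      (∑' k : Fin 2 → ℤ, ENNReal.ofReal (4 * Real.pi ^ 2 * (m - freqNormSq k)) * ‖coeffExt S c k‖ₑ ^ 2) +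
        ENNReal.ofReal r := by
  set P : ℝ≥0∞ := ∑' k : Fin 2 → ℤ, ENNReal.ofReal (4 * Real.pi ^ 2 * (freqNormSq k - m)) *
    ‖coeffExt S c k‖ₑ ^ 2 with hP
  set M : ℝ≥0∞ := ∑' k : Fin 2 → ℤ, ENNReal.ofReal (4 * Real.pi ^ 2 * (m - freqNormSq k)) *
    ‖coeffExt S c k‖ₑ ^ 2 with hM
  have hid := galerkin_shellExcess_eq_toReal_sub_toReal m c
  rw [hid] at h
  have hfinP : P ≠ ⊤ := by
    rw [hP, tsum_ofReal_mul_enorm_sq_coeffExt]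
    exact ENNReal.sum_ne_top.2 fun k _ => ENNReal.mul_ne_top ENNReal.ofReal_ne_top (ENNReal.pow_ne_top enorm_ne_top)
  have hfinM : M ≠ ⊤ := by
    rw [hM, tsum_ofReal_mul_enorm_sq_coeffExt]
    exact ENNReal.sum_ne_top.2 fun k _ => ENNReal.mul_ne_top ENNReal.ofReal_ne_top (ENNReal.pow_ne_top enorm_ne_top)
  have h1 : P.toReal ≤ M.toReal + r := by
    have : P.toReal - M.toReal ≤ r := h
    linarith
  calc P = ENNReal.ofReal P.toReal := (ENNReal.ofReal_toReal hfinP).symm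
    _ ≤ ENNReal.ofReal (M.toReal + r) := ENNReal.ofReal_le_ofReal h1
    _ = ENNReal.ofReal M.toReal + ENNReal.ofReal r := ENNReal.ofReal_add ENNReal.toReal_nonneg hr
    _ = M + ENNReal.ofReal r := by rw [ENNReal.ofReal_toReal hfinM]

/-- **From the clipped series to the pincer inequality**: if `Φ⁺(v) ≤ Φ⁻(v) + ofReal r` for an `L²`
field, then `‖∇v‖₂² ≤ 4π²m‖v‖₂² + r` (spectral identity `‖∇v‖² + Φ⁻ = Φ⁺ + 4π²m∑‖v̂‖²`, Parseval,
and cancellation of the finite `Φ⁻`). [folklore] -/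
theorem eGradNormSq_le_of_shellPlus_le (hm : 0 ≤ m) {v : UnitAddTorus (Fin 2) → EuclideanSpace ℝ (Fin 2)}
    (hv : MemLp v 2 volume) {r : ℝ} (hr : 0 ≤ r)
    (h : (∑' k : Fin 2 → ℤ, ENNReal.ofReal (4 * Real.pi ^ 2 * (freqNormSq k - m)) *
        ‖mFourierCoeff (EuclideanSpace.complexify ∘ v) k‖ₑ ^ 2) ≤
      (∑' k : Fin 2 → ℤ, ENNReal.ofReal (4 * Real.pi ^ 2 * (m - freqNormSq k)) *
        ‖mFourierCoeff (EuclideanSpace.complexify ∘ v) k‖ₑ ^ 2) + ENNReal.ofReal r) :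
    eGradNormSq v ≤ ENNReal.ofReal (4 * Real.pi ^ 2 * m * (∫ x, ‖v x‖ ^ 2) + r) := by
  set M : ℝ≥0∞ := ∑' k : Fin 2 → ℤ, ENNReal.ofReal (4 * Real.pi ^ 2 * (m - freqNormSq k)) *
    ‖mFourierCoeff (EuclideanSpace.complexify ∘ v) k‖ₑ ^ 2 with hM
  have hid := eGradNormSq_add_shellMinus_eq m hm v
  have hMfin : M ≠ ⊤ := ne_top_of_le_ne_top ENNReal.ofReal_ne_top (shellMinus_le m hm hv)
  have hE : 0 ≤ ∫ x, ‖v x‖ ^ 2 := integral_nonneg fun _ => sq_nonneg _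
  have hpars : ∑' k : Fin 2 → ℤ, ‖mFourierCoeff (EuclideanSpace.complexify ∘ v) k‖ₑ ^ 2 =
      ENNReal.ofReal (∫ x, ‖v x‖ ^ 2) := by
    rw [Torus.tsum_enorm_sq_mFourierCoeff_complexify hv, Torus.lintegral_enorm_sq_eq_ofReal hv]
  have hsum : eGradNormSq v + M ≤ (ENNReal.ofReal r + ENNReal.ofReal (4 * Real.pi ^ 2 * m) *
      ENNReal.ofReal (∫ x, ‖v x‖ ^ 2)) + M := by
    calc eGradNormSq v + M = _ := hid
      _ ≤ (M + ENNReal.ofReal r) + ENNReal.ofReal (4 * Real.pi ^ 2 * m) * ENNReal.ofReal (∫ x, ‖v x‖ ^ 2) := by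
          rw [hpars]; exact add_le_add h le_rfl
      _ = (ENNReal.ofReal r + ENNReal.ofReal (4 * Real.pi ^ 2 * m) * ENNReal.ofReal (∫ x, ‖v x‖ ^ 2)) + M := by
          ring
  have hfinal := (ENNReal.add_le_add_iff_right hMfin).1 hsum
  refine hfinal.trans (le_of_eq ?_)
  rw [← ENNReal.ofReal_mul (by positivity), ← ENNReal.ofReal_add hr (by positivity)]
  congr 1
  ring

end Spectral

end Summit.AnomalousDissipation.AnomalousDissipation.Theorems.TwodBoundedEnergyZeroMomentum.Negative

end
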